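import Literature.Probability.LatticeModels.AnisotropicPlaneRotatorTorusBoxCriterion
import Literature.Probability.LatticeModels.LayeredPlaneRotatorSusceptibilityDichotomy
import HarnessLib

/-!
# Lieb's star in closed form: the explicit weak-interlayer DISORDER REGION of the layered plane rotator,
# free and periodic boundary conditions

Topic `Literature/Probability/LatticeModels`. E. H. Lieb, Comm. Math. Phys. **77** (1980) 127, Theorem 4 (the
Bessel-ratio star `∑_{b ∼ 0} u(J_b) < 1`) and p. 128 (boxes) [Lieb1980]; B. Simon, ibid. 111, Thm 1.3 [Simon1980CMP];
D. E. Amos, Math. Comp. **28** (1974) 239, eq. (11) (`u(x) = I₁(x)/I₀(x) ≤ x/√(x² + 4)`) [Amos1974]; the layered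
couplings `(J, J, εJ)` of L. L. Liu, H. E. Stanley, Phys. Rev. Lett. **29** (1972) 927 [LiuStanley1972].

The tree holds Lieb's star for the layered rotator `(J∥, J∥, J⊥)` at inverse temperature `β` in AMOS' FORM on every
finite `Λ ⊂ ℤ³` with free boundary conditions (`PlaneRotator.twoPoint_layered_le_pow_amos(_of_le)`:
`⟨cos(θ_a − θ_c)⟩_Λ ≤ (4x/√(x²+4) + 2y/√(y²+4))^{‖a − c‖₁}` whenever `βJ∥ ≤ x`, `βJ⊥ ≤ y`), the explicit-window
TEMPLATE on the torus `(ℤ/Lℤ)³` (`AnisotropicRotator.corr_layered_le_pow_of_certificate`: a rational certificate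
`r₁² ≤ x² + 4`, `4x/r₁ + y ≤ m₀` gives `corr ≤ m₀^{dist_∞}`), six point windows `(K₀, ε₀, m₀)` with three-digit
thresholds (`LayeredPlaneRotatorExplicitWindow.lean`, `…_window_half`, `…_near_star`, …), and the Simon–Lieb dichotomy
for the stack at every `J⊥` (`AnisotropicRotator.torus_susceptibility_bounded_iff_summable_layered`,
`plateau_le_of_summable_layered`). This file replaces the point windows by the REGION they sample:

* §1 algebra of the Amos ratio `t/√(t² + 4)`: the temperature form `(J/T)/√((J/T)² + 4) = J/√(J² + 4T²)` and the
  closure of the star, `4J∥/√(J∥² + 4T²) < 1 ↔ T > (√15/2)·J∥ = 1.936…·J∥`;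
* §2 free boundary conditions: on the STAR REGION `4x/√(x²+4) + 2y/√(y²+4) < 1` the infinite-volume two-point function
  decays with the ℓ¹ distance and is summable (`summable_layered_of_amos_star_lt_one`);
* §3 the torus: (A) directly from the template with the real certificate `r₁ = √(x²+4)`, on the (slightly smaller)
  region `4x/√(x²+4) + y < 1`, an EXPLICIT ceiling `plateau_L ≤ (∑_{z ∈ ℤ³} m^{‖z‖_∞})/L³`, `m = 4x/√(x²+4) + y`, for
  every `L ≥ 4`, and the torus susceptibility bound `∑_y corr x y ≤ ∑_z m^{‖z‖_∞}`; (B) through the dichotomy, on the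
  full star region, `plateau_L ≤ C/L³` and `χ^{3D,per}_L ≤ C` for `L ≥ L₁` (qualitative `C`, `L₁`);
* §4 the temperature form: for `J∥ > 0`, `J⊥ ≥ 0`, `T > 0` with `4J∥/√(J∥² + 4T²) + J⊥/T < 1` — equivalently
  `T > (√15/2)·J∥` and `J⊥ < T·(1 − 4J∥/√(J∥² + 4T²))` — the periodic layered rotator at `β = 1/T` carries no long-range
  order (`plateau_L ≤ C/L³` explicitly), and on `4J∥/√(J∥²+4T²) + 2J⊥/√(J⊥²+4T²) < 1` the free stack has finite
  susceptibility; the point windows of record `(1/2, 0.0298)`, `(0.51, 0.0115)`, `(2/5, 1/5)`, `(1/3, 1/3)`,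
  `(1/4, 1/2)` are points of both regions (`(1/5, 5/8)` of the free one only: `0.398 + 0.625 > 1` but
  `0.398 + 0.597 < 1`), and the `J⊥ → 0` closure of both is Lieb's star `T = (√15/2)·J∥`.

In words (classical layered XY comparison model of the `hubbard-tc` cell, MO-S3 2D→3D grammar): the weak-interlayer
high-temperature phase certified by Lieb's star is ONE closed-form region in the `(J∥/T, J⊥/T)` plane, the same for free
and periodic boundary conditions up to the vertical-bond accounting (`2u(y) ≤ 2y/√(y²+4)` free, `≤ y` in the torus
template), whose boundary meets `J⊥ = 0` at `T/J∥ = √15/2`; below that line only the qualitative Onsager window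
(`plateau_eventually_le_of_lt_log_one_add_sqrt_two`, `T_χ^{3D} → T_χ^{2D} ≤ J∥/log(1+√2)`) is in the tree.

## What this is not

A classical comparison-model statement (no electrons). No new decimal: the only constants are Lieb's star, Amos'
bound and `√15/2`; `plateau_L → 0` is absence of long-range order at these couplings, not the value of a transition
temperature; the Kosterlitz–Thouless window between these ceilings and the infrared-bound floor
`1 − (1 + ln(J∥/J⊥)/(2π))/(βJ∥)` is untouched.
-/

noncomputable section

open MeasureTheory Finset Filter
open scoped BigOperators Topology

namespace Literature.Probability.LatticeModels

open PlaneRotator Literature.Barriers.CriticalPhenomena Literature.Barriers.CriticalPhenomena.LongRangeIsing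
open Literature.MathematicalPhysics.QuantumLattice

/-! ## §1 Algebra of the Amos ratio -/

section Algebra

/-- `0 ≤ t/√(t² + 4)` for `t ≥ 0`. [folklore] -/
private theorem amos_ratio_nonneg {t : ℝ} (ht : 0 ≤ t) : 0 ≤ t / Real.sqrt (t ^ 2 + 4) :=
  div_nonneg ht (Real.sqrt_nonneg _)

/-- `‖y‖_∞ ≤ ‖y‖₁` on `ℤ^ν`. [folklore] -/
private theorem supNorm_le_l1Norm'' {ν : ℕ} (y : Site ν) : Site.supNorm y ≤ l1Norm y :=
  Site.supNorm_le_iff.2 fun i =>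
    Finset.single_le_sum (f := fun i => (y i).natAbs) (fun _ _ => Nat.zero_le _) (Finset.mem_univ i)

/-- **The Amos ratio in temperature units**: at `β = 1/T`, `T > 0`, the ratio `x/√(x² + 4)` at `x = J/T` is
`J/√(J² + 4T²)`. [cite: Amos1974, eq. (11) (m = 0) — algebra] -/
theorem amos_ratio_temperature {T : ℝ} (hT : 0 < T) (J : ℝ) :
    T⁻¹ * J / Real.sqrt ((T⁻¹ * J) ^ 2 + 4) = J / Real.sqrt (J ^ 2 + 4 * T ^ 2) := by
  have hT2 : 0 < T ^ 2 := by positivity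
  have hq : (T⁻¹ * J) ^ 2 + 4 = (J ^ 2 + 4 * T ^ 2) / T ^ 2 := by
    field_simp
  rw [hq, Real.sqrt_div' _ hT2.le, Real.sqrt_sq hT.le]
  have hS : 0 ≤ Real.sqrt (J ^ 2 + 4 * T ^ 2) := Real.sqrt_nonneg _
  by_cases hS0 : Real.sqrt (J ^ 2 + 4 * T ^ 2) = 0
  · rw [hS0, zero_div, div_zero, div_zero]
  · field_simp

/-- **The closure of Lieb's star at `J⊥ = 0` is `T = (√15/2)·J∥`**: for `J ≥ 0` and `T > 0`,
`4J/√(J² + 4T²) < 1 ↔ (√15/2)·J < T` (`16J² < J² + 4T²`). In coupling units: `4x/√(x²+4) < 1 ↔ x < 2/√15 = 0.5164`.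
[cite: Lieb1980, Theorem 4 (β_c ≥ 0.52 for ν = 2); Amos1974, eq. (11) (m = 0)] -/
theorem four_mul_amos_ratio_lt_one_iff {J T : ℝ} (hJ : 0 ≤ J) (hT : 0 < T) :
    4 * (J / Real.sqrt (J ^ 2 + 4 * T ^ 2)) < 1 ↔ Real.sqrt 15 / 2 * J < T := by
  have hpos : 0 < J ^ 2 + 4 * T ^ 2 := by positivity
  have hS : 0 < Real.sqrt (J ^ 2 + 4 * T ^ 2) := Real.sqrt_pos.2 hpos
  have h15 : Real.sqrt 15 ^ 2 = 15 := Real.sq_sqrt (by norm_num)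
  have h15pos : 0 < Real.sqrt 15 := Real.sqrt_pos.2 (by norm_num)
  rw [mul_div_assoc', div_lt_one hS, Real.lt_sqrt (by positivity)]
  constructor
  · intro h
    -- `16 J² < J² + 4T²` ⇒ `(√15/2·J)² < T²`
    have h1 : (Real.sqrt 15 / 2 * J) ^ 2 < T ^ 2 := by nlinarith
    exact lt_of_pow_lt_pow_left₀ 2 hT.le h1
  · intro h
    have h1 : (Real.sqrt 15 / 2 * J) ^ 2 < T ^ 2 :=
      pow_lt_pow_left₀ h (by positivity) two_ne_zero
    nlinarith

/-- The temperature form of the curve condition: `J⊥ < T·(1 − 4J∥/√(J∥² + 4T²))` is `4J∥/√(J∥²+4T²) + J⊥/T < 1`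
(`T > 0`). [cite: Lieb1980, Theorem 4; Amos1974, eq. (11) (m = 0) — algebra] -/
theorem amos_curve_lt_one_of_lt {Jp Jz T : ℝ} (hT : 0 < T)
    (h : Jz < T * (1 - 4 * (Jp / Real.sqrt (Jp ^ 2 + 4 * T ^ 2)))) :
    4 * (Jp / Real.sqrt (Jp ^ 2 + 4 * T ^ 2)) + Jz / T < 1 := by
  have h1 : Jz / T < 1 - 4 * (Jp / Real.sqrt (Jp ^ 2 + 4 * T ^ 2)) := by
    rw [div_lt_iff₀ hT]; linarith
  linarith

/-- Nonemptiness of the `J⊥`-interval: for `T > (√15/2)·J∥` (`J∥ ≥ 0`) the threshold `T·(1 − 4J∥/√(J∥² + 4T²))` is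
positive. [cite: Lieb1980, Theorem 4 (β_c ≥ 0.52 for ν = 2); Amos1974, eq. (11) (m = 0)] -/
theorem amos_threshold_pos {Jp T : ℝ} (hJ : 0 ≤ Jp) (hT : Real.sqrt 15 / 2 * Jp < T) :
    0 < T * (1 - 4 * (Jp / Real.sqrt (Jp ^ 2 + 4 * T ^ 2))) := by
  have hT0 : 0 < T := lt_of_le_of_lt (by positivity) hT
  have h := (four_mul_amos_ratio_lt_one_iff hJ hT0).2 hT
  exact mul_pos hT0 (by linarith)

end Algebra

/-! ## §2 Free boundary conditions: the star region -/

namespace PlaneRotator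

section Free

variable [MeasurableSpace Circle] [BorelSpace Circle]

/-- **Lieb's star in Amos' form for the infinite-volume two-point function.** For `β, J∥, J⊥ ≥ 0` with `βJ∥ ≤ x`,
`βJ⊥ ≤ y` and all `u, v ∈ ℤ³`: `G^{3D}_{β; J∥, J⊥}(u, v) ≤ (4x/√(x²+4) + 2y/√(y²+4))^{‖u − v‖₁}` (the volume bound
`twoPoint_layered_le_pow_amos_of_le` in every box, then the supremum). [cite: Lieb1980, Theorem 4; Amos1974, eq. (11) (m = 0); Simon1980CMP, Thm 1.3] -/
theorem infTwoPointLayered_le_pow_amos_of_le {β Jp Jz x y : ℝ} (hβ : 0 ≤ β) (hp : 0 ≤ Jp) (hz : 0 ≤ Jz)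
    (hx : β * Jp ≤ x) (hy : β * Jz ≤ y) (u v : Site 3) :
    infTwoPointLayered β Jp Jz u v ≤
      (4 * (x / Real.sqrt (x ^ 2 + 4)) + 2 * (y / Real.sqrt (y ^ 2 + 4))) ^ l1Norm (u - v) := by
  have hx0 : 0 ≤ x := (mul_nonneg hβ hp).trans hx
  have hy0 : 0 ≤ y := (mul_nonneg hβ hz).trans hy
  have hb0 : 0 ≤ 4 * (x / Real.sqrt (x ^ 2 + 4)) + 2 * (y / Real.sqrt (y ^ 2 + 4)) :=
    add_nonneg (mul_nonneg (by norm_num) (amos_ratio_nonneg hx0))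
      (mul_nonneg (by norm_num) (amos_ratio_nonneg hy0))
  refine infTwoPointLayered_le_of_forall_box fun n => ?_
  by_cases h : u ∈ box 3 n ∧ v ∈ box 3 n
  · rw [volTwoPointLayered_of_mem β Jp Jz h.1 h.2]
    exact twoPoint_layered_le_pow_amos_of_le hβ hp hz hx hy (box 3 n) ⟨u, h.1⟩ ⟨v, h.2⟩
  · unfold volTwoPointLayered
    rw [dif_neg h]
    exact pow_nonneg hb0 _

/-- **The free stack has finite susceptibility on the star region.** If `βJ∥ ≤ x`, `βJ⊥ ≤ y` and
`4x/√(x²+4) + 2y/√(y²+4) < 1` then `∑_{z ∈ ℤ³} G^{3D}_{β; J∥, J⊥}(0, z) < ∞` (`‖z‖₁ ≥ ‖z‖_∞` and the lattice sum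
`∑_z m^{‖z‖_∞} < ∞`). [cite: Lieb1980, Theorem 4 and p. 128; Amos1974, eq. (11) (m = 0); Simon1980CMP, Thm 1.3] -/
theorem summable_layered_of_amos_star_lt_one {β Jp Jz x y : ℝ} (hβ : 0 ≤ β) (hp : 0 ≤ Jp) (hz : 0 ≤ Jz)
    (hx : β * Jp ≤ x) (hy : β * Jz ≤ y)
    (hm : 4 * (x / Real.sqrt (x ^ 2 + 4)) + 2 * (y / Real.sqrt (y ^ 2 + 4)) < 1) :
    Summable fun z : Site 3 => infTwoPointLayered β Jp Jz 0 z := by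
  have hx0 : 0 ≤ x := (mul_nonneg hβ hp).trans hx
  have hy0 : 0 ≤ y := (mul_nonneg hβ hz).trans hy
  set m : ℝ := 4 * (x / Real.sqrt (x ^ 2 + 4)) + 2 * (y / Real.sqrt (y ^ 2 + 4)) with hmdef
  have hm0 : 0 ≤ m := add_nonneg (mul_nonneg (by norm_num) (amos_ratio_nonneg hx0))
    (mul_nonneg (by norm_num) (amos_ratio_nonneg hy0))
  refine summable_of_le_pow_supNorm_div (ν := 3) (R := 1) le_rfl (m := m) (C := 1) hm0 hm
    (fun z => infTwoPointLayered_nonneg hβ hp hz 0 z) fun z => ?_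
  have h := infTwoPointLayered_le_pow_amos_of_le hβ hp hz hx hy 0 z
  rw [zero_sub, l1Norm_neg] at h
  rw [Nat.div_one, one_mul]
  exact h.trans (pow_le_pow_of_le_one hm0 hm.le (supNorm_le_l1Norm'' z))

/-- The coupling form: `4βJ∥/√((βJ∥)²+4) + 2βJ⊥/√((βJ⊥)²+4) < 1 ⇒ ∑_z G^{3D}(0, z) < ∞`.
[cite: Lieb1980, Theorem 4 and p. 128; Amos1974, eq. (11) (m = 0); Simon1980CMP, Thm 1.3] -/
theorem summable_layered_of_amos_star_lt_one' {β Jp Jz : ℝ} (hβ : 0 ≤ β) (hp : 0 ≤ Jp) (hz : 0 ≤ Jz)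
    (hm : 4 * (β * Jp / Real.sqrt ((β * Jp) ^ 2 + 4)) + 2 * (β * Jz / Real.sqrt ((β * Jz) ^ 2 + 4)) < 1) :
    Summable fun z : Site 3 => infTwoPointLayered β Jp Jz 0 z :=
  summable_layered_of_amos_star_lt_one hβ hp hz le_rfl le_rfl hm

end Free

end PlaneRotator

/-! ## §3 Periodic boundary conditions -/

namespace AnisotropicRotator

variable {L : ℕ} [NeZero L]

section Periodic

/-- **(A) Lieb's star on the torus with the real certificate.** For `β, J∥, J⊥ ≥ 0` with `βJ∥ ≤ x`, `0 < x`,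
`βJ⊥ ≤ y`, every `L ≥ 4` and `a, c ∈ (ℤ/Lℤ)³`: `corr (βJ∥, βJ∥, βJ⊥) a c ≤ (4x/√(x²+4) + y)^{dist_∞(a, c)}`
(`corr_layered_le_pow_of_certificate` with `r₁ = √(x² + 4)`). [cite: Lieb1980, Theorem 4 (β_c ≥ 0.52 for ν = 2); Amos1974, eq. (11) (m = 0)] -/
theorem corr_layered_le_pow_amos_of_le {β Jp Jz x y : ℝ} (hβ : 0 ≤ β) (hp : 0 ≤ Jp) (hz : 0 ≤ Jz)
    (hx0 : 0 < x) (hy0 : 0 ≤ y) (hx : β * Jp ≤ x) (hy : β * Jz ≤ y) (hL : 4 ≤ L) (a c : TorusSite 3 L) :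
    corr (layeredCoupling (β * Jp) (β * Jz)) a c ≤ (4 * (x / Real.sqrt (x ^ 2 + 4)) + y) ^ torusDist a c := by
  have hr : 0 < Real.sqrt (x ^ 2 + 4) := Real.sqrt_pos.2 (by positivity)
  refine corr_layered_le_pow_of_certificate (r₁ := Real.sqrt (x ^ 2 + 4)) hβ hp hz hx0 hy0 hr
    (le_of_eq (Real.sq_sqrt (by positivity))) (le_of_eq ?_) hx hy hL a c
  ring

/-- The coupling form of (A): for `0 < βJ∥`, `corr ≤ (4βJ∥/√((βJ∥)²+4) + βJ⊥)^{dist_∞}` on every torus `L ≥ 4`.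
[cite: Lieb1980, Theorem 4 (β_c ≥ 0.52 for ν = 2); Amos1974, eq. (11) (m = 0)] -/
theorem corr_layered_le_pow_amos {β Jp Jz : ℝ} (hβ : 0 ≤ β) (hp : 0 ≤ Jp) (hz : 0 ≤ Jz) (hx0 : 0 < β * Jp)
    (hL : 4 ≤ L) (a c : TorusSite 3 L) :
    corr (layeredCoupling (β * Jp) (β * Jz)) a c ≤
      (4 * (β * Jp / Real.sqrt ((β * Jp) ^ 2 + 4)) + β * Jz) ^ torusDist a c :=
  corr_layered_le_pow_amos_of_le hβ hp hz hx0 (mul_nonneg hβ hz) le_rfl le_rfl hL a c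

/-- **(A) The torus susceptibility is bounded on the region `4x/√(x²+4) + y < 1`**, explicitly and for every `L ≥ 4`:
`∑_y corr (βJ∥, βJ∥, βJ⊥) x₀ y ≤ ∑_{z ∈ ℤ³} m^{‖z‖_∞}`, `m = 4x/√(x²+4) + y`. [cite: Lieb1980, Theorem 4 and p. 128; Simon1980CMP, Thm 1.3 (exponential decay summed over the lattice)] -/
theorem sum_corr_le_tsum_of_amos_lt_one {β Jp Jz x y : ℝ} (hβ : 0 ≤ β) (hp : 0 ≤ Jp) (hz : 0 ≤ Jz)
    (hx0 : 0 < x) (hy0 : 0 ≤ y) (hx : β * Jp ≤ x) (hy : β * Jz ≤ y)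
    (hm : 4 * (x / Real.sqrt (x ^ 2 + 4)) + y < 1) (hL : 4 ≤ L) (x₀ : TorusSite 3 L) :
    ∑ w : TorusSite 3 L, corr (layeredCoupling (β * Jp) (β * Jz)) x₀ w ≤
      ∑' z : Site 3, (4 * (x / Real.sqrt (x ^ 2 + 4)) + y) ^ Site.supNorm z := by
  set m : ℝ := 4 * (x / Real.sqrt (x ^ 2 + 4)) + y with hmdef
  have hm0 : 0 ≤ m := add_nonneg (mul_nonneg (by norm_num) (amos_ratio_nonneg hx0.le)) hy0
  have hpt : ∀ w : TorusSite 3 L, corr (layeredCoupling (β * Jp) (β * Jz)) x₀ w ≤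
      m ^ aIndex (slabRadii 1) (fun i => ((w - x₀) i).valMinAbs) := fun w => by
    rw [← pow_torusDist_eq_pow_aIndex_one, torusDist_comm' w x₀]
    exact corr_layered_le_pow_amos_of_le hβ hp hz hx0 hy0 hx hy hL x₀ w
  have h := (Finset.sum_le_sum fun w _ => hpt w).trans (sum_pow_aIndex_coord_le_tsum le_rfl hm0 hm x₀)
  simpa only [Nat.div_one] using h

/-- **(A) No long-range order on the torus on the region `4x/√(x²+4) + y < 1`, explicitly**: for `βJ∥ ≤ x`, `0 < x`,
`βJ⊥ ≤ y` and every `L ≥ 4`, `plateau_L(βJ∥, βJ∥, βJ⊥) ≤ (∑_{z ∈ ℤ³} m^{‖z‖_∞}) / L³` with `m = 4x/√(x²+4) + y`.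
[cite: Lieb1980, Theorem 4 and p. 128 (boxes); Simon1980CMP, Thm 1.3; LiuStanley1972, p. 272 (layers (J, J, εJ))] -/
theorem plateau_le_of_amos_lt_one {β Jp Jz x y : ℝ} (hβ : 0 ≤ β) (hp : 0 ≤ Jp) (hz : 0 ≤ Jz)
    (hx0 : 0 < x) (hy0 : 0 ≤ y) (hx : β * Jp ≤ x) (hy : β * Jz ≤ y)
    (hm : 4 * (x / Real.sqrt (x ^ 2 + 4)) + y < 1) (hL : 4 ≤ L) :
    plateau L (layeredCoupling (β * Jp) (β * Jz)) ≤
      (∑' z : Site 3, (4 * (x / Real.sqrt (x ^ 2 + 4)) + y) ^ Site.supNorm z) / (L : ℝ) ^ 3 := by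
  set m : ℝ := 4 * (x / Real.sqrt (x ^ 2 + 4)) + y with hmdef
  have hm0 : 0 ≤ m := add_nonneg (mul_nonneg (by norm_num) (amos_ratio_nonneg hx0.le)) hy0
  have hpt : ∀ a c : TorusSite 3 L, corr (layeredCoupling (β * Jp) (β * Jz)) a c ≤
      m ^ aIndex (slabRadii 1) (fun i => ((a - c) i).valMinAbs) := fun a c => by
    rw [← pow_torusDist_eq_pow_aIndex_one]
    exact corr_layered_le_pow_amos_of_le hβ hp hz hx0 hy0 hx hy hL a c
  have h := plateau_le_of_corr_le_pow le_rfl hm0 hm hpt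
  simpa only [Nat.div_one] using h

/-- **(B) The full star region through the dichotomy.** If `βJ∥ ≤ x`, `βJ⊥ ≤ y` and
`4x/√(x²+4) + 2y/√(y²+4) < 1`, then the torus susceptibility is bounded uniformly in `L ≥ L₁`:
`∃ C L₁, ∀ L ≥ L₁, ∀ x₀, ∑_w corr (βJ∥, βJ∥, βJ⊥) x₀ w ≤ C` (free summability, §2, and
`exists_torus_susceptibility_bound_of_summable_layered`). [cite: Lieb1980, Theorem 4 and p. 128; Simon1980CMP, Thm 1.3; Ginibre1970, Example 4 (free ≤ periodic)] -/
theorem exists_torus_susceptibility_bound_of_amos_star_lt_one {β Jp Jz x y : ℝ} (hβ : 0 ≤ β) (hp : 0 ≤ Jp)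
    (hz : 0 ≤ Jz) (hx : β * Jp ≤ x) (hy : β * Jz ≤ y)
    (hm : 4 * (x / Real.sqrt (x ^ 2 + 4)) + 2 * (y / Real.sqrt (y ^ 2 + 4)) < 1) :
    ∃ (C : ℝ) (L₁ : ℕ), 0 ≤ C ∧ ∀ (L : ℕ) [NeZero L], L₁ ≤ L → ∀ x₀ : TorusSite 3 L,
      ∑ w : TorusSite 3 L, corr (layeredCoupling (β * Jp) (β * Jz)) x₀ w ≤ C :=
  exists_torus_susceptibility_bound_of_summable_layered hβ hp hz
    (PlaneRotator.summable_layered_of_amos_star_lt_one hβ hp hz hx hy hm)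

/-- **(B) No long-range order on the torus on the full star region**: under the same hypotheses
`∃ C L₁, ∀ L ≥ L₁, plateau_L(βJ∥, βJ∥, βJ⊥) ≤ C/L³`. [cite: Lieb1980, Theorem 4 and p. 128; Simon1980CMP, Thm 1.3; FriedliVelenikSMLS2017, (10.39)–(10.42) (the plateau)] -/
theorem exists_plateau_ceiling_of_amos_star_lt_one {β Jp Jz x y : ℝ} (hβ : 0 ≤ β) (hp : 0 ≤ Jp)
    (hz : 0 ≤ Jz) (hx : β * Jp ≤ x) (hy : β * Jz ≤ y)
    (hm : 4 * (x / Real.sqrt (x ^ 2 + 4)) + 2 * (y / Real.sqrt (y ^ 2 + 4)) < 1) :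
    ∃ (C : ℝ) (L₁ : ℕ), 0 ≤ C ∧ ∀ (L : ℕ) [NeZero L], L₁ ≤ L →
      plateau L (layeredCoupling (β * Jp) (β * Jz)) ≤ C / (L : ℝ) ^ 3 :=
  plateau_le_of_summable_layered hβ hp hz
    (PlaneRotator.summable_layered_of_amos_star_lt_one hβ hp hz hx hy hm)

/-- **(B), limit form**: on the full star region `plateau_L → 0`: for every `ε > 0`, `plateau_L ≤ ε` for all large `L`.
[cite: Lieb1980, Theorem 4 and p. 128; Simon1980CMP, Thm 1.3; FriedliVelenikSMLS2017, (10.39)–(10.42) (the plateau)] -/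
theorem plateau_eventually_le_of_amos_star_lt_one {β Jp Jz x y : ℝ} (hβ : 0 ≤ β) (hp : 0 ≤ Jp)
    (hz : 0 ≤ Jz) (hx : β * Jp ≤ x) (hy : β * Jz ≤ y)
    (hm : 4 * (x / Real.sqrt (x ^ 2 + 4)) + 2 * (y / Real.sqrt (y ^ 2 + 4)) < 1) {ε : ℝ} (hε : 0 < ε) :
    ∃ L₀ : ℕ, ∀ (L : ℕ) [NeZero L], L₀ ≤ L → plateau L (layeredCoupling (β * Jp) (β * Jz)) ≤ ε :=
  plateau_eventually_le_of_summable_layered hβ hp hz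
    (PlaneRotator.summable_layered_of_amos_star_lt_one hβ hp hz hx hy hm) hε

end Periodic

/-! ## §4 The temperature form: the closed-form region and its endpoint `(√15/2)·J∥` -/

section Temperature

/-- **No long-range order on the torus on the closed-form region, explicitly.** For `J∥ > 0`, `J⊥ ≥ 0`, `T > 0` with
`m := 4J∥/√(J∥² + 4T²) + J⊥/T < 1`, at `β = 1/T` and for every `L ≥ 4`:
`plateau_L(J∥/T, J∥/T, J⊥/T) ≤ (∑_{z ∈ ℤ³} m^{‖z‖_∞}) / L³`. [cite: Lieb1980, Theorem 4 and p. 128 (boxes); Simon1980CMP, Thm 1.3; LiuStanley1972, p. 272 (layers (J, J, εJ))] -/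
theorem plateau_le_of_amos_curve_lt_one {Jp Jz T : ℝ} (hp : 0 < Jp) (hz : 0 ≤ Jz) (hT : 0 < T)
    (hm : 4 * (Jp / Real.sqrt (Jp ^ 2 + 4 * T ^ 2)) + Jz / T < 1) (hL : 4 ≤ L) :
    plateau L (layeredCoupling (T⁻¹ * Jp) (T⁻¹ * Jz)) ≤
      (∑' z : Site 3, (4 * (Jp / Real.sqrt (Jp ^ 2 + 4 * T ^ 2)) + Jz / T) ^ Site.supNorm z) / (L : ℝ) ^ 3 := by
  have hβ : 0 ≤ T⁻¹ := inv_nonneg.2 hT.le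
  have hx0 : 0 < T⁻¹ * Jp := mul_pos (inv_pos.2 hT) hp
  have e1 : T⁻¹ * Jp / Real.sqrt ((T⁻¹ * Jp) ^ 2 + 4) = Jp / Real.sqrt (Jp ^ 2 + 4 * T ^ 2) :=
    amos_ratio_temperature hT Jp
  have e2 : T⁻¹ * Jz = Jz / T := by rw [inv_mul_eq_div]
  have hm' : 4 * (T⁻¹ * Jp / Real.sqrt ((T⁻¹ * Jp) ^ 2 + 4)) + Jz / T < 1 := by rw [e1]; exact hm
  have h := plateau_le_of_amos_lt_one (y := Jz / T) hβ hp.le hz hx0 (div_nonneg hz hT.le) le_rfl e2.le hm' hL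
  rwa [e1] at h

/-- **The region in words**: for `J∥ > 0`, every temperature `T > (√15/2)·J∥ = 1.936…·J∥` and every interlayer
coupling `0 ≤ J⊥ < T·(1 − 4J∥/√(J∥² + 4T²))`, the periodic layered plane rotator at `β = 1/T` has
`plateau_L ≤ C/L³` for every `L ≥ 4` with the explicit `C = ∑_{z ∈ ℤ³} m^{‖z‖_∞}`, `m = 4J∥/√(J∥²+4T²) + J⊥/T < 1` —
NO long-range order; the `J⊥ → 0` closure of the region is Lieb's star `T = (√15/2)·J∥`, and the point windows of
record (`T ≥ 2J∥ ∧ J⊥ ≤ 0.0298·T`, `T ≥ (100/51)J∥ ∧ J⊥ ≤ 0.0115·T`, …) are points of it.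
[cite: Lieb1980, Theorem 4 (β_c ≥ 0.52 for ν = 2) and p. 128; Simon1980CMP, Thm 1.3; LiuStanley1972, p. 272 (T_c(ε) of the layers (J, J, εJ))] -/
theorem plateau_le_of_lt_amos_threshold {Jp Jz T : ℝ} (hp : 0 < Jp) (hz : 0 ≤ Jz)
    (hT : Real.sqrt 15 / 2 * Jp < T) (hJz : Jz < T * (1 - 4 * (Jp / Real.sqrt (Jp ^ 2 + 4 * T ^ 2))))
    (hL : 4 ≤ L) :
    4 * (Jp / Real.sqrt (Jp ^ 2 + 4 * T ^ 2)) + Jz / T < 1 ∧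
      plateau L (layeredCoupling (T⁻¹ * Jp) (T⁻¹ * Jz)) ≤
        (∑' z : Site 3, (4 * (Jp / Real.sqrt (Jp ^ 2 + 4 * T ^ 2)) + Jz / T) ^ Site.supNorm z) / (L : ℝ) ^ 3 := by
  have hT0 : 0 < T := lt_of_le_of_lt (by positivity) hT
  have hm := amos_curve_lt_one_of_lt hT0 hJz
  exact ⟨hm, plateau_le_of_amos_curve_lt_one hp hz hT0 hm hL⟩

/-- **The torus susceptibility in temperature form**: under `4J∥/√(J∥²+4T²) + J⊥/T < 1`, for every `L ≥ 4` and every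
centre `x₀`, `∑_w corr x₀ w ≤ ∑_{z ∈ ℤ³} m^{‖z‖_∞}` — bounded uniformly in the volume. [cite: Lieb1980, Theorem 4 and p. 128; Simon1980CMP, Thm 1.3 (exponential decay summed over the lattice)] -/
theorem sum_corr_le_tsum_of_amos_curve_lt_one {Jp Jz T : ℝ} (hp : 0 < Jp) (hz : 0 ≤ Jz) (hT : 0 < T)
    (hm : 4 * (Jp / Real.sqrt (Jp ^ 2 + 4 * T ^ 2)) + Jz / T < 1) (hL : 4 ≤ L) (x₀ : TorusSite 3 L) :
    ∑ w : TorusSite 3 L, corr (layeredCoupling (T⁻¹ * Jp) (T⁻¹ * Jz)) x₀ w ≤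
      ∑' z : Site 3, (4 * (Jp / Real.sqrt (Jp ^ 2 + 4 * T ^ 2)) + Jz / T) ^ Site.supNorm z := by
  have hβ : 0 ≤ T⁻¹ := inv_nonneg.2 hT.le
  have hx0 : 0 < T⁻¹ * Jp := mul_pos (inv_pos.2 hT) hp
  have e1 : T⁻¹ * Jp / Real.sqrt ((T⁻¹ * Jp) ^ 2 + 4) = Jp / Real.sqrt (Jp ^ 2 + 4 * T ^ 2) :=
    amos_ratio_temperature hT Jp
  have e2 : T⁻¹ * Jz = Jz / T := by rw [inv_mul_eq_div]
  have hm' : 4 * (T⁻¹ * Jp / Real.sqrt ((T⁻¹ * Jp) ^ 2 + 4)) + Jz / T < 1 := by rw [e1]; exact hm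
  have h := sum_corr_le_tsum_of_amos_lt_one (y := Jz / T) hβ hp.le hz hx0 (div_nonneg hz hT.le) le_rfl e2.le
    hm' hL x₀
  rwa [e1] at h

/-- **The free stack in temperature form**: for `J∥, J⊥ ≥ 0`, `T > 0` with
`4J∥/√(J∥² + 4T²) + 2J⊥/√(J⊥² + 4T²) < 1` (Lieb's star at `β = 1/T` in Amos' form), the free layered rotator has
finite susceptibility `∑_z G^{3D}_{1/T; J∥, J⊥}(0, z) < ∞` — hence (`torus_susceptibility_bounded_iff_summable_layered`)
bounded torus susceptibility and `plateau_L → 0` as well. [cite: Lieb1980, Theorem 4 and p. 128; Amos1974, eq. (11) (m = 0); Simon1980CMP, Thm 1.3] -/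
theorem summable_layered_of_amos_star_temperature [MeasurableSpace Circle] [BorelSpace Circle] {Jp Jz T : ℝ}
    (hp : 0 ≤ Jp) (hz : 0 ≤ Jz) (hT : 0 < T)
    (hm : 4 * (Jp / Real.sqrt (Jp ^ 2 + 4 * T ^ 2)) + 2 * (Jz / Real.sqrt (Jz ^ 2 + 4 * T ^ 2)) < 1) :
    Summable fun z : Site 3 => infTwoPointLayered T⁻¹ Jp Jz 0 z := by
  have hβ : 0 ≤ T⁻¹ := inv_nonneg.2 hT.le
  have e1 : T⁻¹ * Jp / Real.sqrt ((T⁻¹ * Jp) ^ 2 + 4) = Jp / Real.sqrt (Jp ^ 2 + 4 * T ^ 2) :=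
    amos_ratio_temperature hT Jp
  have e2 : T⁻¹ * Jz / Real.sqrt ((T⁻¹ * Jz) ^ 2 + 4) = Jz / Real.sqrt (Jz ^ 2 + 4 * T ^ 2) :=
    amos_ratio_temperature hT Jz
  refine PlaneRotator.summable_layered_of_amos_star_lt_one' hβ hp hz ?_
  rwa [e1, e2]

end Temperature

end AnisotropicRotator

end Literature.Probability.LatticeModels
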